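import Literature.Probability.Percolation.KozmaNitzanReduction
import Literature.Probability.LatticeModels.ProdBernoulliIndependence
import Literature.Probability.LatticeModels.ProdBernoulliClusterLocality
import Literature.Probability.Percolation.PercolationProofs
import HarnessLib

/-!
# Anchored gluing: Kozma–Nitzan's Conjecture 3 holds uniformly in `|A|` on classes of bounded anchoring number

Kozma–Nitzan (arXiv:2401.12397, p. 15, Conjecture 3 = `KozmaNitzan2024_conjecture3`, which by their
Theorem 6 — in the tree `KozmaNitzan2024_thm6_three` — implies `PercolationContinuityZ3`) ask for
`δ(ε)` uniform in the weighted graph and in `|A|` with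
`P(o ↔ A) > 1-δ ∧ (∀ a ∈ A, P(a ↔ b) > 1-δ) → P(o ↔ b) > 1-ε`.

**Anchors.** Call `c` an *anchor* for a part `A_c ⊆ A` if, almost surely, `{o ↔ a} ∩ {c ↔ b} ⊆ {o ↔ b}`
for every `a ∈ A_c` (e.g. because every open `o–a` path meets every open `c–b` path,
`glue_of_shared_vertex`; trivially `c = a` anchors `{a}`, `glue_self`). The Harris inequality then
gives (`real_anchored_sub_le`)

  `P(o ↔ ⋃ parts) - P(o ↔ b) ≤ Σ_c P(o ↔ A_c) · (1 - P(c ↔ b))`,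

so Conjecture 3 holds **with `δ = ε/(K+2)`, uniformly in `|A|` and in the graph, on every instance
whose target set is covered by the parts of at most `K` anchors taken from `A`**
(`conjecture3_of_anchors`). The session-1 bound (`SoloInformedMeanIntersectionGluing`) is the case of
trivial anchors. The two-anchor case (`two_anchor_deficit_le`, `half_product_le_openConn`) is the
abstract content of the *planar-boundary theorem* of the solo census
(`paper/sharpest-statement.md` §5b): for a graph embedded in a disc with `o`, `b`, `A` on the boundary
circle, the first target on each of the two boundary arcs from `o` to `b` is an anchor for the targets
of its arc (interlaced boundary pairs force planar paths to share a vertex), hence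
`P(o ↮ b) ≤ P(o ↮ A) + P(c⁺ ↮ b) + P(c⁻ ↮ b)` — Conjecture 3 with `δ = ε/3` — and
`P(o ↔ b) ≥ ½ · P(o ↔ A) · min_± P(c^± ↔ b)`.

**Companion files.** `SoloInformedOuterplaneJordan` (a combinatorial Jordan lemma for convex
drawings), `SoloInformedOuterplaneAnchors` (four anchors cover the targets of a convex drawing) and
`SoloInformedOuterplaneConjecture3` (`conjecture3_outerplane`: Kozma–Nitzan's Conjecture 3 for all
outerplane weighted graphs with one `δ = ε/6`) build the fully formalised planar-boundary case on
top of `conjecture3_of_anchors`. In `ℤ³` boxes the anchoring number of the Kozma–Nitzan instances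
is unbounded; that is exactly where the conjecture is open.
-/

noncomputable section

namespace Summit.CriticalPhenomena.PercolationContinuityZ3.Theorems

open MeasureTheory Literature.Probability.Percolation Literature.Probability.LatticeModels

variable {n : ℕ}

/-! ### Deterministic gluing lemmas -/

/-- **Shared-vertex gluing.** If in every configuration every open walk `o → a` shares a vertex with
every open walk `c → b`, then `{o ↔ a} ∩ {c ↔ b} ⊆ {o ↔ b}` surely. (This is the interface to
topology: for a graph drawn in a disc with `o, c, a, b` in this cyclic order on the boundary circle,
the hypothesis is the Jordan curve theorem.) -/
theorem glue_of_shared_vertex {V : Type*} (o a c b : V)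
    (h : ∀ (ω : BondConfig V) (p : (openGraph ω).Walk o a) (q : (openGraph ω).Walk c b),
      ∃ v, v ∈ p.support ∧ v ∈ q.support) :
    (openConn o a ∩ openConn c b : Set (BondConfig V)) ⊆ openConn o b := by
  classical
  rintro ω ⟨⟨p⟩, ⟨q⟩⟩
  obtain ⟨v, hvp, hvq⟩ := h ω p q
  exact ⟨(p.takeUntil v hvp).append (q.dropUntil v hvq)⟩

/-- **Trivial anchoring**: `a` anchors `{a}`, since `o ↔ a ↔ b` gives `o ↔ b`. -/
theorem glue_self {V : Type*} (o a b : V) :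
    (openConn o a ∩ openConn a b : Set (BondConfig V)) ⊆ openConn o b :=
  fun _ h => SimpleGraph.Reachable.trans h.1 h.2

/-- Monotonicity of a finite measure under an almost-sure inclusion, real-valued form. -/
private theorem measureReal_mono_ae' {α : Type*} [MeasurableSpace α] {μ : Measure α}
    [IsFiniteMeasure μ] {s t : Set α} (h : ∀ᵐ x ∂μ, x ∈ s → x ∈ t) : μ.real s ≤ μ.real t := by
  simp only [measureReal_def]
  exact ENNReal.toReal_mono (measure_ne_top μ t) (measure_mono_ae h)

/-! ### The anchored Harris bound -/

/-- **Anchored gluing bound** (Harris). For Bernoulli percolation with arbitrary edge weights on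
`Fin n`, parts `A_i` with anchors `c_i` (almost surely `{o ↔ a} ∩ {c_i ↔ b} ⊆ {o ↔ b}` for `a ∈ A_i`):
`P(⋃_i {o ↔ A_i}) - P(o ↔ b) ≤ Σ_i P(o ↔ A_i) · (1 - P(c_i ↔ b))`. -/
theorem real_anchored_sub_le {ι : Type*} (w : Sym2 (Fin n) → unitInterval) (I : Finset ι)
    (part : ι → Finset (Fin n)) (anc : ι → Fin n) (o b : Fin n)
    (hglue : ∀ i ∈ I, ∀ a ∈ part i, ∀ᵐ ω ∂(prodBernoulli w),
      ω ∈ openConn o a → ω ∈ openConn (anc i) b → ω ∈ openConn o b) :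
    (prodBernoulli w).real (⋃ i ∈ I, ⋃ a ∈ part i, openConn o a) -
        (prodBernoulli w).real (openConn o b) ≤
      ∑ i ∈ I, (prodBernoulli w).real (⋃ a ∈ part i, openConn o a) *
        (1 - (prodBernoulli w).real (openConn (anc i) b)) := by
  set μ := prodBernoulli w with hμ
  set U : ι → Set (BondConfig (Fin n)) := fun i => ⋃ a ∈ part i, openConn o a with hU
  set B : Set (BondConfig (Fin n)) := openConn o b with hB
  set X : ι → Set (BondConfig (Fin n)) := fun i => openConn (anc i) b with hX
  -- Step 1: `P(⋃ U) ≤ P(B) + P(⋃ U \ B)`.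
  have hsub : (⋃ i ∈ I, U i) ⊆ B ∪ ((⋃ i ∈ I, U i) \ B) := by
    intro ω hω
    by_cases h : ω ∈ B
    · exact Or.inl h
    · exact Or.inr ⟨hω, h⟩
  have h1 : μ.real (⋃ i ∈ I, U i) ≤ μ.real B + μ.real ((⋃ i ∈ I, U i) \ B) :=
    (measureReal_mono hsub (measure_ne_top _ _)).trans (measureReal_union_le _ _)
  -- Step 2: `⋃ U \ B ⊆ ⋃ (U i \ B)` and the union bound.
  have hsub2 : (⋃ i ∈ I, U i) \ B ⊆ ⋃ i ∈ I, (U i \ B) := by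
    rintro ω ⟨hω, hnot⟩
    simp only [Set.mem_iUnion] at hω ⊢
    obtain ⟨i, hi, hωi⟩ := hω
    exact ⟨i, hi, hωi, hnot⟩
  have h2 : μ.real ((⋃ i ∈ I, U i) \ B) ≤ ∑ i ∈ I, μ.real (U i \ B) :=
    (measureReal_mono hsub2 (measure_ne_top _ _)).trans (measureReal_biUnion_finset_le I _)
  -- Step 3: almost surely `U i \ B ⊆ U i ∩ (X i)ᶜ` (the anchor glues), then Harris.
  have h3 : ∀ i ∈ I, μ.real (U i \ B) ≤ μ.real (U i) * (1 - μ.real (X i)) := by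
    intro i hi
    have hall : ∀ᵐ ω ∂μ, ∀ a ∈ part i,
        (ω ∈ openConn o a → ω ∈ openConn (anc i) b → ω ∈ openConn o b) :=
      (Filter.eventually_all_finset (part i)).mpr (hglue i hi)
    have hae : ∀ᵐ ω ∂μ, ω ∈ U i \ B → ω ∈ U i ∩ (X i)ᶜ := by
      filter_upwards [hall] with ω hω hmem
      obtain ⟨hUi, hnotB⟩ := hmem
      refine ⟨hUi, fun hXi => hnotB ?_⟩
      have hUi' : ω ∈ ⋃ a ∈ part i, openConn o a := hUi
      simp only [Set.mem_iUnion] at hUi'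
      obtain ⟨a, ha, hoa⟩ := hUi'
      exact hω a ha hoa hXi
    have hm : μ.real (U i \ B) ≤ μ.real (U i ∩ (X i)ᶜ) := measureReal_mono_ae' hae
    have hUup : IsUpperSet (U i) := isUpperSet_iUnion₂ fun a _ => isUpperSet_openConn o a
    have hUm : MeasurableSet (U i) :=
      Finset.measurableSet_biUnion _ fun a _ => measurableSet_openConn_holds o a
    have hH := prodBernoulli_harris_upper_lower w hUup (isUpperSet_openConn (anc i) b).compl hUm
      (measurableSet_openConn_holds (anc i) b).compl
    have hc : μ.real (X i)ᶜ = 1 - μ.real (X i) := by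
      rw [measureReal_compl (measurableSet_openConn_holds (anc i) b), probReal_univ]
    rw [hc] at hH
    exact hm.trans hH
  have h4 := Finset.sum_le_sum h3
  linarith

/-- **Gluing with `K` anchors**: if the anchors satisfy `P(c_i ↔ b) ≥ 1 - δ`, then
`P(o ↔ b) ≥ P(⋃_i {o ↔ A_i}) - δ · |I|`. -/
theorem gluing_of_anchors {ι : Type*} (w : Sym2 (Fin n) → unitInterval) (I : Finset ι)
    (part : ι → Finset (Fin n)) (anc : ι → Fin n) (o b : Fin n) {δ : ℝ}
    (hglue : ∀ i ∈ I, ∀ a ∈ part i, ∀ᵐ ω ∂(prodBernoulli w),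
      ω ∈ openConn o a → ω ∈ openConn (anc i) b → ω ∈ openConn o b)
    (hb : ∀ i ∈ I, 1 - δ ≤ (prodBernoulli w).real (openConn (anc i) b)) :
    (prodBernoulli w).real (⋃ i ∈ I, ⋃ a ∈ part i, openConn o a) - δ * I.card ≤
      (prodBernoulli w).real (openConn o b) := by
  have h := real_anchored_sub_le w I part anc o b hglue
  have h' : ∑ i ∈ I, (prodBernoulli w).real (⋃ a ∈ part i, openConn o a) *
        (1 - (prodBernoulli w).real (openConn (anc i) b)) ≤ ∑ _i ∈ I, δ := by
    apply Finset.sum_le_sum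
    intro i hi
    calc (prodBernoulli w).real (⋃ a ∈ part i, openConn o a) *
          (1 - (prodBernoulli w).real (openConn (anc i) b))
        ≤ 1 * δ := by
          apply mul_le_mul measureReal_le_one (by linarith [hb i hi])
            (by linarith [measureReal_le_one (μ := prodBernoulli w) (s := openConn (anc i) b)])
            zero_le_one
      _ = δ := one_mul δ
  have hs : ∑ _i ∈ I, δ = δ * I.card := by
    rw [Finset.sum_const, nsmul_eq_mul, mul_comm]
  linarith

/-- **Kozma–Nitzan Conjecture 3 on classes of bounded anchoring number, uniformly in `|A|`.**
For every `K` and `ε > 0`, with `δ = ε/(K+2)`: whenever `A` is covered by the parts of at most `K`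
anchors `c ∈ A` (almost surely `{o ↔ a} ∩ {c ↔ b} ⊆ {o ↔ b}` for `a` in the part of `c`), the
hypotheses `P(o ↔ A) > 1-δ`, `P(a ↔ b) > 1-δ (a ∈ A)` give `P(o ↔ b) > 1-ε` — with no bound on
`|A|` or on the graph. (`KozmaNitzan2024_conjecture3` is the case where no anchoring structure
is assumed.) -/
theorem conjecture3_of_anchors (K : ℕ) (ε : ℝ) (hε : 0 < ε) :
    ∃ δ : ℝ, 0 < δ ∧ ∀ (n : ℕ) (w : Sym2 (Fin n) → unitInterval) (A Anc : Finset (Fin n))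
      (part : Fin n → Finset (Fin n)) (o b : Fin n),
      Anc.card ≤ K → Anc ⊆ A → (∀ a ∈ A, ∃ c ∈ Anc, a ∈ part c) →
      (∀ c ∈ Anc, ∀ a ∈ part c, ∀ᵐ ω ∂(prodBernoulli w),
        ω ∈ openConn o a → ω ∈ openConn c b → ω ∈ openConn o b) →
      1 - δ < (prodBernoulli w).real (⋃ a ∈ A, openConn o a) →
        (∀ a ∈ A, 1 - δ < (prodBernoulli w).real (openConn a b)) →
          1 - ε < (prodBernoulli w).real (openConn o b) := by
  refine ⟨ε / (K + 2), by positivity, ?_⟩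
  intro n w A Anc part o b hK hAnc hcover hglue hA hb
  have hKr : (Anc.card : ℝ) ≤ K := by exact_mod_cast hK
  -- the cover: `{o ↔ A} ⊆ ⋃_{c ∈ Anc} {o ↔ part c}`
  have hcov : (⋃ a ∈ A, openConn o a : Set (BondConfig (Fin n))) ⊆
      ⋃ c ∈ Anc, ⋃ a ∈ part c, openConn o a := by
    intro ω hω
    simp only [Set.mem_iUnion] at hω ⊢
    obtain ⟨a, ha, hoa⟩ := hω
    obtain ⟨c, hc, hac⟩ := hcover a ha
    exact ⟨c, hc, a, hac, hoa⟩
  have hmono : (prodBernoulli w).real (⋃ a ∈ A, openConn o a) ≤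
      (prodBernoulli w).real (⋃ c ∈ Anc, ⋃ a ∈ part c, openConn o a) :=
    measureReal_mono hcov (measure_ne_top _ _)
  have hg := gluing_of_anchors w Anc part id o b (δ := ε / (K + 2)) hglue
    (fun c hc => (hb c (hAnc hc)).le)
  have hδ0 : (0 : ℝ) ≤ ε / (K + 2) := by positivity
  have hcardδ : ε / (K + 2) * Anc.card ≤ ε / (K + 2) * K :=
    mul_le_mul_of_nonneg_left hKr hδ0
  have hK0 : (0 : ℝ) ≤ K := by positivity
  have hfrac : ε / (K + 2) + ε / (K + 2) * K < ε := by
    rw [← mul_one_add, div_mul_eq_mul_div, div_lt_iff₀ (by positivity)]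
    nlinarith
  linarith

/-! ### Two anchors: the abstract form of the planar-boundary theorem -/

/-- **Two-anchor deficit bound.** If `c⁺` anchors `A⁺` and `c⁻` anchors `A⁻`, then
`P(o ↮ b) ≤ P(o ↮ A⁺ ∪ A⁻) + P(c⁺ ↮ b) + P(c⁻ ↮ b)` (no Harris needed: on `{o ↔ A⁺ ∪ A⁻} ∖ {o ↔ b}`
one of the two anchors is cut from `b`). For a graph drawn in a disc with `o, b, A` on the boundary
and `c^±` the first targets on the two arcs from `o` to `b`, this is Conjecture 3 with `δ = ε/3`. -/
theorem two_anchor_deficit_le (w : Sym2 (Fin n) → unitInterval) (Ap Am : Finset (Fin n))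
    (cp cm o b : Fin n)
    (hp : ∀ a ∈ Ap, ∀ᵐ ω ∂(prodBernoulli w), ω ∈ openConn o a → ω ∈ openConn cp b → ω ∈ openConn o b)
    (hm : ∀ a ∈ Am, ∀ᵐ ω ∂(prodBernoulli w), ω ∈ openConn o a → ω ∈ openConn cm b → ω ∈ openConn o b) :
    1 - (prodBernoulli w).real (openConn o b) ≤
      (1 - (prodBernoulli w).real ((⋃ a ∈ Ap, openConn o a) ∪ ⋃ a ∈ Am, openConn o a)) +
        (1 - (prodBernoulli w).real (openConn cp b)) +
          (1 - (prodBernoulli w).real (openConn cm b)) := by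
  set μ := prodBernoulli w with hμ
  set U : Set (BondConfig (Fin n)) := (⋃ a ∈ Ap, openConn o a) ∪ ⋃ a ∈ Am, openConn o a with hU
  set B : Set (BondConfig (Fin n)) := openConn o b with hB
  have hallp : ∀ᵐ ω ∂μ, ∀ a ∈ Ap, (ω ∈ openConn o a → ω ∈ openConn cp b → ω ∈ openConn o b) :=
    (Filter.eventually_all_finset Ap).mpr hp
  have hallm : ∀ᵐ ω ∂μ, ∀ a ∈ Am, (ω ∈ openConn o a → ω ∈ openConn cm b → ω ∈ openConn o b) :=
    (Filter.eventually_all_finset Am).mpr hm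
  -- almost surely `U \ B ⊆ {cp ↮ b} ∪ {cm ↮ b}`
  have hae : ∀ᵐ ω ∂μ, ω ∈ U \ B → ω ∈ ((openConn cp b)ᶜ ∪ (openConn cm b)ᶜ : Set _) := by
    filter_upwards [hallp, hallm] with ω hωp hωm hmem
    obtain ⟨hUω, hnotB⟩ := hmem
    rcases hUω with hP | hM
    · simp only [Set.mem_iUnion] at hP
      obtain ⟨a, ha, hoa⟩ := hP
      exact Or.inl fun hX => hnotB (hωp a ha hoa hX)
    · simp only [Set.mem_iUnion] at hM
      obtain ⟨a, ha, hoa⟩ := hM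
      exact Or.inr fun hX => hnotB (hωm a ha hoa hX)
  have hdiff : μ.real (U \ B) ≤ μ.real (openConn cp b)ᶜ + μ.real (openConn cm b)ᶜ :=
    (measureReal_mono_ae' hae).trans (measureReal_union_le _ _)
  have hsub : U ⊆ B ∪ (U \ B) := by
    intro ω hω
    by_cases h : ω ∈ B
    · exact Or.inl h
    · exact Or.inr ⟨hω, h⟩
  have h1 : μ.real U ≤ μ.real B + μ.real (U \ B) :=
    (measureReal_mono hsub (measure_ne_top _ _)).trans (measureReal_union_le _ _)
  have hcp : μ.real (openConn cp b)ᶜ = 1 - μ.real (openConn cp b) := by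
    rw [measureReal_compl (measurableSet_openConn_holds cp b), probReal_univ]
  have hcm : μ.real (openConn cm b)ᶜ = 1 - μ.real (openConn cm b) := by
    rw [measureReal_compl (measurableSet_openConn_holds cm b), probReal_univ]
  rw [hcp, hcm] at hdiff
  linarith

/-- **Half-product bound with two anchors** (Harris): `P(o ↔ b) ≥ ½ · P(o ↔ A⁺ ∪ A⁻) ·
min (P(c⁺ ↔ b)) (P(c⁻ ↔ b))`. The factor `½` is what the abstract anchoring structure gives; the
abstract four-event inequality with factor `1` is false (two independent fair events). -/
theorem half_product_le_openConn (w : Sym2 (Fin n) → unitInterval) (Ap Am : Finset (Fin n))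
    (cp cm o b : Fin n)
    (hp : ∀ a ∈ Ap, ∀ᵐ ω ∂(prodBernoulli w), ω ∈ openConn o a → ω ∈ openConn cp b → ω ∈ openConn o b)
    (hm : ∀ a ∈ Am, ∀ᵐ ω ∂(prodBernoulli w), ω ∈ openConn o a → ω ∈ openConn cm b → ω ∈ openConn o b) :
    (1 / 2) * (prodBernoulli w).real ((⋃ a ∈ Ap, openConn o a) ∪ ⋃ a ∈ Am, openConn o a) *
        min ((prodBernoulli w).real (openConn cp b)) ((prodBernoulli w).real (openConn cm b)) ≤
      (prodBernoulli w).real (openConn o b) := by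
  set μ := prodBernoulli w with hμ
  set Up : Set (BondConfig (Fin n)) := ⋃ a ∈ Ap, openConn o a with hUp
  set Um : Set (BondConfig (Fin n)) := ⋃ a ∈ Am, openConn o a with hUm
  set B : Set (BondConfig (Fin n)) := openConn o b with hB
  -- each anchored part glued to its anchor lands in `B`, almost surely
  have keyp : μ.real Up * μ.real (openConn cp b) ≤ μ.real B := by
    have hall : ∀ᵐ ω ∂μ, ∀ a ∈ Ap, (ω ∈ openConn o a → ω ∈ openConn cp b → ω ∈ openConn o b) :=
      (Filter.eventually_all_finset Ap).mpr hp
    have hae : ∀ᵐ ω ∂μ, ω ∈ Up ∩ openConn cp b → ω ∈ B := by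
      filter_upwards [hall] with ω hω hmem
      obtain ⟨hU, hX⟩ := hmem
      have hU' : ω ∈ ⋃ a ∈ Ap, openConn o a := hU
      simp only [Set.mem_iUnion] at hU'
      obtain ⟨a, ha, hoa⟩ := hU'
      exact hω a ha hoa hX
    have hH := prodBernoulli_harris w (isUpperSet_iUnion₂ fun a _ => isUpperSet_openConn o a)
      (isUpperSet_openConn cp b)
      (Finset.measurableSet_biUnion Ap fun a _ => measurableSet_openConn_holds o a)
      (measurableSet_openConn_holds cp b)
    exact hH.trans (measureReal_mono_ae' hae)
  have keym : μ.real Um * μ.real (openConn cm b) ≤ μ.real B := by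
    have hall : ∀ᵐ ω ∂μ, ∀ a ∈ Am, (ω ∈ openConn o a → ω ∈ openConn cm b → ω ∈ openConn o b) :=
      (Filter.eventually_all_finset Am).mpr hm
    have hae : ∀ᵐ ω ∂μ, ω ∈ Um ∩ openConn cm b → ω ∈ B := by
      filter_upwards [hall] with ω hω hmem
      obtain ⟨hU, hX⟩ := hmem
      have hU' : ω ∈ ⋃ a ∈ Am, openConn o a := hU
      simp only [Set.mem_iUnion] at hU'
      obtain ⟨a, ha, hoa⟩ := hU'
      exact hω a ha hoa hX
    have hH := prodBernoulli_harris w (isUpperSet_iUnion₂ fun a _ => isUpperSet_openConn o a)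
      (isUpperSet_openConn cm b)
      (Finset.measurableSet_biUnion Am fun a _ => measurableSet_openConn_holds o a)
      (measurableSet_openConn_holds cm b)
    exact hH.trans (measureReal_mono_ae' hae)
  have hunion : μ.real (Up ∪ Um) ≤ μ.real Up + μ.real Um := measureReal_union_le _ _
  have hmin_p : min (μ.real (openConn cp b)) (μ.real (openConn cm b)) ≤ μ.real (openConn cp b) :=
    min_le_left _ _
  have hmin_m : min (μ.real (openConn cp b)) (μ.real (openConn cm b)) ≤ μ.real (openConn cm b) :=
    min_le_right _ _
  have hmin0 : 0 ≤ min (μ.real (openConn cp b)) (μ.real (openConn cm b)) :=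
    le_min measureReal_nonneg measureReal_nonneg
  have hUp0 : 0 ≤ μ.real Up := measureReal_nonneg
  have hUm0 : 0 ≤ μ.real Um := measureReal_nonneg
  have kp' : μ.real Up * min (μ.real (openConn cp b)) (μ.real (openConn cm b)) ≤ μ.real B :=
    (mul_le_mul_of_nonneg_left hmin_p hUp0).trans keyp
  have km' : μ.real Um * min (μ.real (openConn cp b)) (μ.real (openConn cm b)) ≤ μ.real B :=
    (mul_le_mul_of_nonneg_left hmin_m hUm0).trans keym
  nlinarith

end Summit.CriticalPhenomena.PercolationContinuityZ3.Theorems
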